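import Summits.CriticalPhenomena.PercolationContinuityZ3.Theorems.PercGamblersRuinBGNOffTheFloorBridges
import HarnessLib

/-!
# `BGNOffTheFloor` (stmt-CriticalPhenomena-7773) — the scale-free jump-world gluing (weakest glue of line `registered`)

Crux `Summit.CriticalPhenomena.PercolationContinuityZ3.Theses.PercGamblersRuin.BGNOffTheFloor`
(route `PercGamblersRuin`, item stmt-CriticalPhenomena-7773), line `registered` (birth skeleton
`Cruxes/BGNOffTheFloor/Lines/birth.lean`, lead c7). Support lemmas (`--supports`), all proved.

Notation: `e_n(a,b) = P_{p_c}(0 ⟷ {z₀ = b n} in {z₀ > -a n})`, `f(A,L) = P_{p_c}(0 ⟷ {z₀ = L} in {z₀ > -A})`,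
`OffFloorAt a b :≡ liminf_n e_n(a,b) = 0`; the crux is `∀ a < b, OffFloorAt a b`;
`UnitRatioBGN :≡ ∃ b₀, liminf_m f(m, b₀ m) = 0` (registered stub `stub_unitRatioBGN`);
`ClimbExtension :≡ ∀ 1 ≤ a < b, OffFloorAt a (b+1) → OffFloorAt a b` (`↔ (UnitRatioBGN → crux)`,
`OffFloor.climbExtension_iff_unit_imp`).

The composition of the line consumes its glue stub (`stub_planeGluing`, the separating-plane instance of
Kozma–Nitzan's Conjecture 1: `e_n(a,b) · f((a+b) n, n) ≤ e_n(a,b+1)`) only through `ClimbExtension`, and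
`ClimbExtension` is free when `θ(p_c) = 0`. What is really used is therefore a JUMP-WORLD statement, and the
weakest quantitative one of the line's shape is SCALE-FREE:

  `JumpScaleFreeGluing :≡ θ(p_c) > 0 → ∀ 1 ≤ a < b, ∃ c > 0, ∃ N, ∀ n ≥ N, c · e_n(a,b) ≤ e_n(a,b+1)`

(length quasi-multiplicativity of the climb probability above a fixed receding floor, asked only in a
world with `θ(p_c) > 0`). This file records, kernel-checked:

* `OffFloor.climbExtension_of_jumpScaleFreeGluing` — `JumpScaleFreeGluing → ClimbExtension` (θ-blind: the
  case `θ(p_c) = 0` by `OffFloor.offFloor_of_theta_eq_zero`, the case `θ(p_c) > 0` by the constant `c`);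
* `jumpScaleFreeGluing_of_planeGluingEventually` — it is WEAKER than the weak plane gluing of
  `PercGamblersRuinBGNOffTheFloorBridges` §2 (`PlaneGluingEventually`: `e_n(a,b) f((a+b)n,n) ≤ C e_n(a,b+1)` for
  `n ≥ N`), because in a jump world the Kozma–Nitzan gluing factor is bounded below,
  `f((a+b) n, n) ≥ f(n, n) ≥ θ(p_c)/2` (`OffFloor.climb_real_mono`, `OffFloor.theta_le_two_mul_climb_diag`),
  so `c = θ(p_c) / (2 max(C,1))` works; a fortiori it is weaker than the registered `stub_planeGluing`
  (`planeGluingEventually_of_planeGluing`);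
* `jumpScaleFreeGluing_of_theta_eq_zero` — it is conjunct-implied (vacuous when `θ(p_c) = 0`), hence, like the
  crux, refutable only together with `θ(p_c) > 0`;
* `bgnOffTheFloor_of_unitRatioBGN_of_jumpScaleFreeGluing`, `bgnOffTheFloor_iff_unitRatioBGN_of_jumpScaleFreeGluing`
  — `UnitRatioBGN ∧ JumpScaleFreeGluing → BGNOffTheFloor`, and under the glue `BGNOffTheFloor ↔ UnitRatioBGN`;
* `stub_splitGlueScaleFree` — the registered structural STUB 13 of the line, signature verbatim.

Why the scale-free shape is the honest one (lead c7, MC evidence `MC-planeGluing-c7.md`, job j026700 on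
the item): at `p_c(ℤ³)` the conditional extension ratio `e_n(a,b+1)/e_n(a,b)` is numerically scale-free
(`0.747 ± 0.004` for `(a,b) = (1,2)`, `n = 2…12`), while the Kozma–Nitzan factor `f((a+b)n,n)` decays like a
one-arm probability (`≈ 0.61 n^{-0.42}`), so the registered plane gluing over-asks by a factor growing like
`n^{0.44}` and is numerically exposed only at `n = 1` (margin 24.6 %). None of this is provable θ-blindly
today (no length quasi-multiplicativity for 3D arm events); the file only fixes the minimal shape.

References: G. Kozma, S. Nitzan, *A reduction of the θ(p_c) = 0 problem to a conjectured inequality*,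
arXiv:2401.12397 (2024), Conjecture 1 (p. 3); D. J. Barsky, G. R. Grimmett, C. M. Newman, *Percolation in
half-spaces*, Probab. Theory Related Fields 90 (1991) 111–148.
-/

noncomputable section

namespace Summit.CriticalPhenomena.PercolationContinuityZ3.Theorems

open MeasureTheory Filter Literature.Probability.Percolation Literature.Probability.LatticeModels
open scoped Topology

namespace OffFloor

/-- **Scale-free jump-world gluing implies the ladder step, θ-blindly.** If `θ(p_c) > 0` forces, for all
`1 ≤ a < b`, constants `c > 0`, `N` with `c · e_n(a,b) ≤ e_n(a,b+1)` for `n ≥ N`, then for `1 ≤ a < b`,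
`liminf_n e_n(a,b+1) = 0 → liminf_n e_n(a,b) = 0`: when `θ(p_c) = 0` the conclusion holds outright
(`offFloor_of_theta_eq_zero`); otherwise `e_n(a,b+1) < c ε` gives `e_n(a,b) < ε` for `n ≥ N`. [folklore] -/
theorem climbExtension_of_jumpScaleFreeGluing
    (hglue : 0 < theta (zdGraph 3) 0 (criticalProbI 3) → ∀ a b : ℕ, 1 ≤ a → a < b →
      ∃ c : ℝ, 0 < c ∧ ∃ N : ℕ, ∀ n : ℕ, N ≤ n →
        c * (bondPercolation (zdGraph 3) (criticalProbI 3)).real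
            {ω | ∃ y : Site 3, y 0 = ((b * n : ℕ) : ℤ) ∧
              ω ∈ openConnIn {z : Site 3 | -((a * n : ℕ) : ℤ) < z 0} 0 y} ≤
          (bondPercolation (zdGraph 3) (criticalProbI 3)).real
            {ω | ∃ y : Site 3, y 0 = (((b + 1) * n : ℕ) : ℤ) ∧
              ω ∈ openConnIn {z : Site 3 | -((a * n : ℕ) : ℤ) < z 0} 0 y}) :
    ∀ a b : ℕ, 1 ≤ a → a < b →
      (∀ ε : ℝ, 0 < ε → ∃ᶠ n : ℕ in atTop,
        (bondPercolation (zdGraph 3) (criticalProbI 3)).real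
            {ω | ∃ y : Site 3, y 0 = (((b + 1) * n : ℕ) : ℤ) ∧
              ω ∈ openConnIn {z : Site 3 | -((a * n : ℕ) : ℤ) < z 0} 0 y} < ε) →
      ∀ ε : ℝ, 0 < ε → ∃ᶠ n : ℕ in atTop,
        (bondPercolation (zdGraph 3) (criticalProbI 3)).real
            {ω | ∃ y : Site 3, y 0 = ((b * n : ℕ) : ℤ) ∧
              ω ∈ openConnIn {z : Site 3 | -((a * n : ℕ) : ℤ) < z 0} 0 y} < ε := by
  intro a b ha hab hhyp ε hε
  by_cases hθ : theta (zdGraph 3) 0 (criticalProbI 3) = 0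
  · exact offFloor_of_theta_eq_zero hθ a b (by omega) ε hε
  · have hθpos : 0 < theta (zdGraph 3) 0 (criticalProbI 3) :=
      lt_of_le_of_ne measureReal_nonneg (Ne.symm hθ)
    obtain ⟨c, hc, N, hN⟩ := hglue hθpos a b ha hab
    refine ((hhyp (c * ε) (by positivity)).and_eventually (eventually_ge_atTop N)).mono ?_
    rintro n ⟨hn, hnN⟩
    have hcn := hN n hnN
    -- `c · e_n(a,b) ≤ e_n(a,b+1) < c ε`, divide by `c > 0`
    exact lt_of_mul_lt_mul_left (lt_of_le_of_lt hcn hn) hc.le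

end OffFloor

/-- **The weak plane gluing implies the scale-free jump-world gluing.** From `e_n(a,b) · f((a+b) n, n) ≤
C · e_n(a,b+1)` (`n ≥ N`) and, in a jump world, `f((a+b) n, n) ≥ f(n,n) ≥ θ(p_c)/2`
(`OffFloor.climb_real_mono`, `OffFloor.theta_le_two_mul_climb_diag`), one gets
`(θ(p_c) / (2 max(C,1))) · e_n(a,b) ≤ e_n(a,b+1)` for `n ≥ max N 1`. [folklore] -/
theorem jumpScaleFreeGluing_of_planeGluingEventually
    (hplane : ∀ a b : ℕ, 1 ≤ a → a < b → ∃ C : ℝ, ∃ N : ℕ, ∀ n : ℕ, N ≤ n →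
      (bondPercolation (zdGraph 3) (criticalProbI 3)).real
          {ω | ∃ y : Site 3, y 0 = ((b * n : ℕ) : ℤ) ∧
            ω ∈ openConnIn {z : Site 3 | -((a * n : ℕ) : ℤ) < z 0} 0 y} *
        (bondPercolation (zdGraph 3) (criticalProbI 3)).real
          {ω | ∃ y : Site 3, y 0 = ((n : ℕ) : ℤ) ∧
            ω ∈ openConnIn {z : Site 3 | -(((a + b) * n : ℕ) : ℤ) < z 0} 0 y} ≤
      C * (bondPercolation (zdGraph 3) (criticalProbI 3)).real
          {ω | ∃ y : Site 3, y 0 = (((b + 1) * n : ℕ) : ℤ) ∧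
            ω ∈ openConnIn {z : Site 3 | -((a * n : ℕ) : ℤ) < z 0} 0 y}) :
    0 < theta (zdGraph 3) 0 (criticalProbI 3) → ∀ a b : ℕ, 1 ≤ a → a < b →
      ∃ c : ℝ, 0 < c ∧ ∃ N : ℕ, ∀ n : ℕ, N ≤ n →
        c * (bondPercolation (zdGraph 3) (criticalProbI 3)).real
            {ω | ∃ y : Site 3, y 0 = ((b * n : ℕ) : ℤ) ∧
              ω ∈ openConnIn {z : Site 3 | -((a * n : ℕ) : ℤ) < z 0} 0 y} ≤
          (bondPercolation (zdGraph 3) (criticalProbI 3)).real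
            {ω | ∃ y : Site 3, y 0 = (((b + 1) * n : ℕ) : ℤ) ∧
              ω ∈ openConnIn {z : Site 3 | -((a * n : ℕ) : ℤ) < z 0} 0 y} := by
  intro hθpos a b ha hab
  set θ := theta (zdGraph 3) 0 (criticalProbI 3) with hθdef
  obtain ⟨C, N, hC⟩ := hplane a b ha hab
  set C' : ℝ := max C 1 with hC'def
  have hC'pos : 0 < C' := lt_of_lt_of_le one_pos (le_max_right C 1)
  refine ⟨θ / (2 * C'), by positivity, max N 1, fun n hn => ?_⟩
  have hnN : N ≤ n := le_trans (le_max_left _ _) hn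
  have hn1 : 1 ≤ n := le_trans (le_max_right _ _) hn
  have hpl := hC n hnN
  have hdiag := OffFloor.theta_le_two_mul_climb_diag n hn1
  have hmono : (bondPercolation (zdGraph 3) (criticalProbI 3)).real
        {ω | ∃ y : Site 3, y 0 = (n : ℤ) ∧ ω ∈ openConnIn {z : Site 3 | -(n : ℤ) < z 0} 0 y} ≤
      (bondPercolation (zdGraph 3) (criticalProbI 3)).real
        {ω | ∃ y : Site 3, y 0 = ((n : ℕ) : ℤ) ∧
          ω ∈ openConnIn {z : Site 3 | -(((a + b) * n : ℕ) : ℤ) < z 0} 0 y} := by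
    refine OffFloor.climb_real_mono (criticalProbI 3) (A := (n : ℤ)) (A' := (((a + b) * n : ℕ) : ℤ))
      (L := (n : ℤ)) (L' := (n : ℤ)) ?_ (by positivity) le_rfl
    have : n ≤ (a + b) * n := Nat.le_mul_of_pos_left n (by omega)
    exact_mod_cast this
  -- abbreviate the three probabilities
  set X := (bondPercolation (zdGraph 3) (criticalProbI 3)).real
      {ω | ∃ y : Site 3, y 0 = ((b * n : ℕ) : ℤ) ∧
        ω ∈ openConnIn {z : Site 3 | -((a * n : ℕ) : ℤ) < z 0} 0 y} with hX
  set Y := (bondPercolation (zdGraph 3) (criticalProbI 3)).real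
      {ω | ∃ y : Site 3, y 0 = ((n : ℕ) : ℤ) ∧
        ω ∈ openConnIn {z : Site 3 | -(((a + b) * n : ℕ) : ℤ) < z 0} 0 y} with hY
  set Z := (bondPercolation (zdGraph 3) (criticalProbI 3)).real
      {ω | ∃ y : Site 3, y 0 = (((b + 1) * n : ℕ) : ℤ) ∧
        ω ∈ openConnIn {z : Site 3 | -((a * n : ℕ) : ℤ) < z 0} 0 y} with hZ
  have hYge : θ / 2 ≤ Y := by linarith
  have hX0 : 0 ≤ X := measureReal_nonneg
  have hZ0 : 0 ≤ Z := measureReal_nonneg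
  have hCZ : C * Z ≤ C' * Z := mul_le_mul_of_nonneg_right (le_max_left C 1) hZ0
  -- `X θ/2 ≤ X Y ≤ C Z ≤ C' Z`, so `(θ/(2C')) X ≤ Z`
  have h1 : X * (θ / 2) ≤ C' * Z :=
    le_trans (mul_le_mul_of_nonneg_left hYge hX0) (le_trans hpl hCZ)
  calc θ / (2 * C') * X = X * (θ / 2) / C' := by field_simp
    _ ≤ C' * Z / C' := div_le_div_of_nonneg_right h1 hC'pos.le
    _ = Z := by field_simp

/-- **The scale-free jump-world gluing is conjunct-implied**: vacuous when `θ(p_c) = 0`. [folklore] -/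
theorem jumpScaleFreeGluing_of_theta_eq_zero (hθ : theta (zdGraph 3) 0 (criticalProbI 3) = 0) :
    0 < theta (zdGraph 3) 0 (criticalProbI 3) → ∀ a b : ℕ, 1 ≤ a → a < b →
      ∃ c : ℝ, 0 < c ∧ ∃ N : ℕ, ∀ n : ℕ, N ≤ n →
        c * (bondPercolation (zdGraph 3) (criticalProbI 3)).real
            {ω | ∃ y : Site 3, y 0 = ((b * n : ℕ) : ℤ) ∧
              ω ∈ openConnIn {z : Site 3 | -((a * n : ℕ) : ℤ) < z 0} 0 y} ≤
          (bondPercolation (zdGraph 3) (criticalProbI 3)).real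
            {ω | ∃ y : Site 3, y 0 = (((b + 1) * n : ℕ) : ℤ) ∧
              ω ∈ openConnIn {z : Site 3 | -((a * n : ℕ) : ℤ) < z 0} 0 y} :=
  fun hpos => absurd hθ (ne_of_gt hpos)

/-- **`UnitRatioBGN ∧ JumpScaleFreeGluing → BGNOffTheFloor`**: the scale-free jump-world gluing yields the
ladder step (`OffFloor.climbExtension_of_jumpScaleFreeGluing`), and the ladder step is exactly the
implication `UnitRatioBGN → BGNOffTheFloor` (`OffFloor.climbExtension_iff_unit_imp`). [folklore] -/
theorem bgnOffTheFloor_of_unitRatioBGN_of_jumpScaleFreeGluing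
    (hunit : ∃ b₀ : ℕ, ∀ ε : ℝ, 0 < ε → ∃ᶠ m : ℕ in atTop,
      (bondPercolation (zdGraph 3) (criticalProbI 3)).real
        {ω | ∃ y : Site 3, y 0 = ((b₀ * m : ℕ) : ℤ) ∧
          ω ∈ openConnIn {z : Site 3 | -((m : ℕ) : ℤ) < z 0} 0 y} < ε)
    (hglue : 0 < theta (zdGraph 3) 0 (criticalProbI 3) → ∀ a b : ℕ, 1 ≤ a → a < b →
      ∃ c : ℝ, 0 < c ∧ ∃ N : ℕ, ∀ n : ℕ, N ≤ n →
        c * (bondPercolation (zdGraph 3) (criticalProbI 3)).real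
            {ω | ∃ y : Site 3, y 0 = ((b * n : ℕ) : ℤ) ∧
              ω ∈ openConnIn {z : Site 3 | -((a * n : ℕ) : ℤ) < z 0} 0 y} ≤
          (bondPercolation (zdGraph 3) (criticalProbI 3)).real
            {ω | ∃ y : Site 3, y 0 = (((b + 1) * n : ℕ) : ℤ) ∧
              ω ∈ openConnIn {z : Site 3 | -((a * n : ℕ) : ℤ) < z 0} 0 y}) :
    Theses.PercGamblersRuin.BGNOffTheFloor :=
  OffFloor.climbExtension_iff_unit_imp.1 (OffFloor.climbExtension_of_jumpScaleFreeGluing hglue) hunit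

/-- **Under the scale-free jump-world gluing the crux is its existential shadow**:
`JumpScaleFreeGluing → (BGNOffTheFloor ↔ UnitRatioBGN)`. [folklore] -/
theorem bgnOffTheFloor_iff_unitRatioBGN_of_jumpScaleFreeGluing
    (hglue : 0 < theta (zdGraph 3) 0 (criticalProbI 3) → ∀ a b : ℕ, 1 ≤ a → a < b →
      ∃ c : ℝ, 0 < c ∧ ∃ N : ℕ, ∀ n : ℕ, N ≤ n →
        c * (bondPercolation (zdGraph 3) (criticalProbI 3)).real
            {ω | ∃ y : Site 3, y 0 = ((b * n : ℕ) : ℤ) ∧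
              ω ∈ openConnIn {z : Site 3 | -((a * n : ℕ) : ℤ) < z 0} 0 y} ≤
          (bondPercolation (zdGraph 3) (criticalProbI 3)).real
            {ω | ∃ y : Site 3, y 0 = (((b + 1) * n : ℕ) : ℤ) ∧
              ω ∈ openConnIn {z : Site 3 | -((a * n : ℕ) : ℤ) < z 0} 0 y}) :
    Theses.PercGamblersRuin.BGNOffTheFloor ↔
      ∃ b₀ : ℕ, ∀ ε : ℝ, 0 < ε → ∃ᶠ m : ℕ in atTop,
        (bondPercolation (zdGraph 3) (criticalProbI 3)).real
          {ω | ∃ y : Site 3, y 0 = ((b₀ * m : ℕ) : ℤ) ∧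
            ω ∈ openConnIn {z : Site 3 | -((m : ℕ) : ℤ) < z 0} 0 y} < ε :=
  ⟨unitRatioBGN_of_bgnOffTheFloor,
    fun hunit => bgnOffTheFloor_of_unitRatioBGN_of_jumpScaleFreeGluing hunit hglue⟩

/-! ## The registered structural stub of line `registered` (lead c7 reshape), signature verbatim -/

/-- **Registered STUB 13 `stub_splitGlueScaleFree` of line `registered` (birth) of `BGNOffTheFloor`,
signature verbatim**: `UnitRatioBGN → JumpScaleFreeGluing → BGNOffTheFloor`
(`bgnOffTheFloor_of_unitRatioBGN_of_jumpScaleFreeGluing`) — the weakest gluing of the line's shape: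
scale-free, and asked only in a world with `θ(p_c) > 0`. [folklore] -/
theorem stub_splitGlueScaleFree :
    (∃ b₀ : ℕ, ∀ ε : ℝ, 0 < ε → ∃ᶠ m : ℕ in atTop,
      (bondPercolation (zdGraph 3) (criticalProbI 3)).real
        {ω | ∃ y : Site 3, y 0 = ((b₀ * m : ℕ) : ℤ) ∧
          ω ∈ openConnIn {z : Site 3 | -((m : ℕ) : ℤ) < z 0} 0 y} < ε) →
    (0 < theta (zdGraph 3) 0 (criticalProbI 3) → ∀ a b : ℕ, 1 ≤ a → a < b →
      ∃ c : ℝ, 0 < c ∧ ∃ N : ℕ, ∀ n : ℕ, N ≤ n →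
        c * (bondPercolation (zdGraph 3) (criticalProbI 3)).real
            {ω | ∃ y : Site 3, y 0 = ((b * n : ℕ) : ℤ) ∧
              ω ∈ openConnIn {z : Site 3 | -((a * n : ℕ) : ℤ) < z 0} 0 y} ≤
          (bondPercolation (zdGraph 3) (criticalProbI 3)).real
            {ω | ∃ y : Site 3, y 0 = (((b + 1) * n : ℕ) : ℤ) ∧
              ω ∈ openConnIn {z : Site 3 | -((a * n : ℕ) : ℤ) < z 0} 0 y}) →
    Summit.CriticalPhenomena.PercolationContinuityZ3.Theses.PercGamblersRuin.BGNOffTheFloor :=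
  fun hunit hglue => bgnOffTheFloor_of_unitRatioBGN_of_jumpScaleFreeGluing hunit hglue

end Summit.CriticalPhenomena.PercolationContinuityZ3.Theorems

end
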